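import Mathlib
import Summits.Ventures.HodgeRepro2.T5CyclotomicDyadic

/-!
# T5ResidualShape — the «residual shape» `2` non-split in `K`, split completely in `F⁺`: `|D| = 3`

Tier-5 support (seat p3) for sub-step N2 of `route/T5-N2-route-3.md`, §N2.8.2(e) («residual
shape: 2 non-split in K AND 2 split completely in F⁺») and §N2.9.4 (the pair
`(g₂(F⁺), |D_set|) = (3, 3)`): the dyadic configuration that Hilbert reciprocity alone cannot
exclude, in number-field form.

Setting: number fields `ℚ ⊆ F ⊆ E` and `ℚ ⊆ K ⊆ E` (the cubic `F⁺`, the quadratic `K` and the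
sextic `E = F⁺K`; only the algebra structures are used — the compositum itself is not
constructed).  If `2` is INERT in `K` (every prime of `K` above `2` has `f = 2`) then every prime
`P` of `E` above `2` has EVEN inertia degree (`two_dvd_inertiaDeg`: `f(P|2) = f(𝔮|2)·f(P|𝔮)`);
hence a dyadic prime `𝔭` of `F` with `f(𝔭|2) = 1` has `f(P|𝔭) = f(P|2)` even, so `f(P|𝔭) = 2 = [E : F]`
and `𝔭` is NON-SPLIT in `E` (`ncard_primesOver_eq_one`, for Galois `E/F`).  If moreover `2` splits
completely in `F` (`e = f = 1` at every dyadic prime, `[F : ℚ] = 3`), then `F` has three dyadic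
primes, all non-split in `E`: `D` = all, `D.ncard = 3` (`nonSplit_eq_univ`, `ncard_nonSplit`).

The instance of the record: `F⁺` = the cyclic cubic of conductor 31 (`2` splits completely there —
`T5CyclotomicUnramified.ncard_primesOver_two_cubic_31`), `K` = a quadratic field with `2` inert
(e.g. `ℚ(√−3)`: `T5CyclotomicDyadic.inertiaDeg_two_quadratic_nine`); the hypotheses below are
exactly these two facts.  Honest scope: that `E = F⁺K` exists with `[E : F⁺] = 2` and is Galois
over `F⁺` (a compositum of linearly disjoint fields) stays prose.  Uses an L-value-free
non-vanishing device: NO (README §8(d)).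
-/

namespace Summit.Ventures.HodgeRepro2.T5ResidualShape

open Ideal NumberField

variable {F K E : Type*} [Field F] [NumberField F] [Field K] [Field E] [NumberField E]
  [Algebra F E] [Algebra K E]

/-- The ideal `(2)` of `ℤ`. -/
local notation3 "𝒑₂" => (span {((2 : ℕ) : ℤ)} : Ideal ℤ)

omit [NumberField E] in
/-- If `2` is inert in the quadratic field `K ⊆ E` (every prime of `K` above `2` has inertia
degree `2`), every prime `P` of `E` above `2` has even inertia degree:
`f(P|2) = f(𝔮|2)·f(P|𝔮)` with `𝔮 = P ∩ 𝓞 K` (`Ideal.inertiaDeg_tower`). -/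
theorem two_dvd_inertiaDeg
    (hK : ∀ 𝔮 : Ideal (𝓞 K), 𝔮.IsPrime → 𝔮.LiesOver 𝒑₂ → 𝔮.inertiaDeg ℤ = 2)
    (P : Ideal (𝓞 E)) [P.IsPrime] [P.LiesOver 𝒑₂] : 2 ∣ P.inertiaDeg ℤ := by
  haveI : (P.under (𝓞 K)).LiesOver 𝒑₂ := LiesOver.tower_bot P (P.under (𝓞 K)) 𝒑₂
  rw [inertiaDeg_tower (R := ℤ) (P.under (𝓞 K)) P, hK _ inferInstance inferInstance]
  exact dvd_mul_right 2 _

/-- A dyadic prime `𝔭` of `F` with `f(𝔭|2) = 1` is NON-SPLIT in the quadratic extension `E/F`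
when `2` is inert in `K ⊆ E`: `f(P|𝔭) = f(P|2)` is even and `≤ [E : F] = 2`, so `f(P|𝔭) = 2` and
`#{P | 𝔭}·(e·2) = 2` forces one prime. -/
theorem ncard_primesOver_eq_one [IsGalois F E] (hFE : Module.finrank F E = 2)
    (hK : ∀ 𝔮 : Ideal (𝓞 K), 𝔮.IsPrime → 𝔮.LiesOver 𝒑₂ → 𝔮.inertiaDeg ℤ = 2)
    (𝔭 : Ideal (𝓞 F)) [𝔭.IsPrime] [𝔭.LiesOver 𝒑₂] (hf : 𝔭.inertiaDeg ℤ = 1) :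
    (𝔭.primesOver (𝓞 E)).ncard = 1 := by
  obtain ⟨⟨P, hP, hPF⟩⟩ := 𝔭.nonempty_primesOver (S := 𝓞 E)
  haveI : P.LiesOver 𝒑₂ := LiesOver.trans P 𝔭 𝒑₂
  have h2 := two_dvd_inertiaDeg (K := K) hK P
  have ht := inertiaDeg_tower (R := ℤ) 𝔭 P
  rw [hf, one_mul] at ht
  rw [ht] at h2
  have hle := T5CyclotomicDyadic.inertiaDeg_le_finrank_of_isGalois 𝔭 P
  rw [hFE] at hle
  have hpos : 0 < P.inertiaDeg (𝓞 F) := inertiaDeg_pos P (𝓞 F)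
  have hf2 : P.inertiaDeg (𝓞 F) = 2 := by
    interval_cases h : P.inertiaDeg (𝓞 F) <;> omega
  have hg := T5CyclotomicDyadic.ncard_primesOver_mul 𝔭 P
  rw [hf2, hFE] at hg
  have he : 0 < P.ramificationIdx (𝓞 F) := ramificationIdx_pos P (𝓞 F)
  nlinarith [hg, he]

/-- The RESIDUAL SHAPE: `2` inert in `K` and split completely in `F` (every dyadic prime of `F`
has `e = f = 1`) ⟹ EVERY dyadic prime of `F` is non-split in `E`: `D` = all dyadic places. -/
theorem nonSplit_eq_univ [IsGalois F E] (hFE : Module.finrank F E = 2)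
    (hK : ∀ 𝔮 : Ideal (𝓞 K), 𝔮.IsPrime → 𝔮.LiesOver 𝒑₂ → 𝔮.inertiaDeg ℤ = 2)
    (hF : ∀ 𝔭 ∈ 𝒑₂.primesOver (𝓞 F), 𝔭.ramificationIdx ℤ * 𝔭.inertiaDeg ℤ = 1) :
    {𝔭 ∈ 𝒑₂.primesOver (𝓞 F) | (𝔭.primesOver (𝓞 E)).ncard = 1} = 𝒑₂.primesOver (𝓞 F) := by
  rw [Set.sep_eq_self_iff_mem_true]
  intro 𝔭 h𝔭
  haveI := h𝔭.1
  haveI := h𝔭.2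
  exact ncard_primesOver_eq_one (K := K) hFE hK 𝔭 (Nat.eq_one_of_mul_eq_one_left (hF 𝔭 h𝔭))

/-- The RESIDUAL SHAPE counted: with `[F : ℚ] = 3`, `2` split completely in `F` and inert in `K`,
`|D| = 3` (`T5CyclotomicDyadic.ncard_primesOver_eq_finrank_of_forall` for the three dyadic primes
of `F`). -/
theorem ncard_nonSplit [IsGalois F E] (hFE : Module.finrank F E = 2)
    (hK : ∀ 𝔮 : Ideal (𝓞 K), 𝔮.IsPrime → 𝔮.LiesOver 𝒑₂ → 𝔮.inertiaDeg ℤ = 2)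
    (hF : ∀ 𝔭 ∈ 𝒑₂.primesOver (𝓞 F), 𝔭.ramificationIdx ℤ * 𝔭.inertiaDeg ℤ = 1)
    (hF3 : Module.finrank ℚ F = 3) :
    {𝔭 ∈ 𝒑₂.primesOver (𝓞 F) | (𝔭.primesOver (𝓞 E)).ncard = 1}.ncard = 3 := by
  rw [nonSplit_eq_univ (K := K) hFE hK hF,
    T5CyclotomicDyadic.ncard_primesOver_eq_finrank_of_forall 𝒑₂ hF, hF3]

end Summit.Ventures.HodgeRepro2.T5ResidualShape
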